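import Mathlib
import HarnessLib
import Summits.FinalStateConjecture.FinalStateConjecture.Statement
import Literature.Geometry.Lorentzian.CausalFutureProofs
import Literature.Geometry.Lorentzian.CausalityPushUp
import Literature.Geometry.Lorentzian.HypersurfaceRestriction

/-!
# Crux `DrainImpliesDisperse` (stmt-FinalStateConjecture-17283), line `registered`
# (birth skeleton, reshape r1) — registered stub `stub_honestEnd`

HONESTY OF A PROPER, FUTURE-TIMELIKE-FIBRED LATE CHART (pure causal geometry, valid in every
Cauchy development; no decay and no field equation is used). Let `Ψ : E4 → M` be smooth, an open
embedding of the late half-space `{x⁰ > τ₀}`, proper on the closed half-space (`C := Ψ{x⁰ ≥ τ₀}`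
closed in `M`) and with `Ψ_* ∂₀` future timelike on `{x⁰ ≥ τ₀}`; put `U := Ψ{x⁰ > τ₀}` (open:
the range of the open embedding) and `O := J⁺(ι X) ∩ I⁻(U)`
(`Summit.FinalStateConjecture.exteriorOf`).

* (H1) `U ⊆ I⁻(U)`: the chart line `s ↦ Ψ(x + s ∂₀)`, `s ∈ [0, 1]`, is a future timelike curve
  (chain rule: its velocity is `dΨ(∂₀)` at `x + s ∂₀`, future timelike by hypothesis since the
  time coordinate stays `≥ τ₀`), so `Ψ x ≪ Ψ(x + ∂₀) ∈ U`.
* (H2) for `τ₁ ≥ τ₀`, `O ∖ Ψ{x⁰ > τ₁} ⊆ J⁻(Ψ{x⁰ = τ₁})`: a point `p = Ψ x ∈ C` not in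
  `Ψ{x⁰ > τ₁}` has `τ₀ ≤ x⁰ ≤ τ₁` and the chart line carries it causally to the slab point
  `Ψ(x + (τ₁ - x⁰) ∂₀)`; a point `p ∉ C` of `I⁻(U)` is the endpoint of a past-directed timelike
  curve `γ : [a, b] → M` from `q = γ a ∈ U ⊆ C`, whose LAST CONTACT `σ = max {s | γ s ∈ C}` with the
  closed set `C` (it exists: `γ` is continuous, `C` closed, `γ b = p ∉ C`) is not in the open set
  `U` (else `γ` would stay in `U ⊆ C` slightly longer), hence is a point `Ψ y` with `y⁰ = τ₀`; then
  `p ∈ J⁻(γ σ)`, `γ σ = Ψ y ∈ J⁻(Ψ{x⁰ = τ₁})` by the chart line, and `J⁻ ∘ J⁻ = J⁻`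
  (`causalFuture_causalFuture_eq` for the reversed time orientation; O'Neill 1983, Ch. 14, p. 402).

Mathlib + the Literature cone only; no definitions, no named facts.
-/

noncomputable section

open scoped Manifold ContDiff Topology
open Filter Set Topology TopologicalSpace Literature.Geometry.Lorentzian

namespace Summit.FinalStateConjecture.FinalStateConjecture.Theorems.DrainImpliesDisperse

-- D-0017: single-problem summit, `Summit.<S>.<S>.…` by design
-- (cf. lakefile `weak.linter.dupNamespace`).
set_option linter.dupNamespace false

/-! ### Regularity side condition -/

/-- `2 ≤ ∞` in `ℕ∞ω` (regularity side condition of the causality theorems). -/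
private lemma two_le_infty : (2 : ℕ∞ω) ≤ ∞ := WithTop.coe_le_coe.mpr le_top

/-! ### Causal pasts: monotonicity, transitivity, curve endpoints -/

section CausalPast

variable {E : Type*} [NormedAddCommGroup E] [NormedSpace ℝ E] {H : Type*} [TopologicalSpace H]
  {I : ModelWithCorners ℝ E H} {n : ℕ∞ω} {M : Type*} [TopologicalSpace M] [ChartedSpace H M]
  [IsManifold I ∞ M] {g : LorentzianMetric I n M} {τ : TimeOrientation g}

/-- `I⁻` is monotone in the set (time dual of `chronologicalFuture_mono`). -/
private theorem chronologicalPast_mono {S T : Set M} (h : S ⊆ T) :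
    g.chronologicalPast τ S ⊆ g.chronologicalPast τ T :=
  LorentzianMetric.chronologicalFuture_mono h

/-- `J⁻` is monotone in the set (time dual of `causalFuture_mono`). -/
private theorem causalPast_mono {S T : Set M} (h : S ⊆ T) :
    g.causalPast τ S ⊆ g.causalPast τ T :=
  LorentzianMetric.causalFuture_mono h

/-- `I⁻(S) ⊆ J⁻(S)` (time dual of `chronologicalFuture_subset_causalFuture`). -/
private theorem chronologicalPast_subset_causalPast (S : Set M) :
    g.chronologicalPast τ S ⊆ g.causalPast τ S :=
  LorentzianMetric.chronologicalFuture_subset_causalFuture g τ.reverse S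

/-- `J⁻(J⁻(S)) = J⁻(S)` on a manifold without boundary with a `C²` metric
(`causalFuture_causalFuture_eq` for the reversed time orientation). -/
private theorem causalPast_causalPast_eq [BoundarylessManifold I M] (hn : 2 ≤ n) (S : Set M) :
    g.causalPast τ (g.causalPast τ S) = g.causalPast τ S :=
  LorentzianMetric.causalFuture_causalFuture_eq hn S

/-- The final point of a past-directed timelike segment lies in the chronological past of its
initial point: if `γ` is future timelike for `τ.reverse` on `[a, b]`, `a < b`, then
`γ b ∈ I⁻(γ a)`. -/
private theorem mem_chronologicalPast_of_reverse_curve {γ : ℝ → M} {a b : ℝ} (hab : a < b)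
    (hγ : g.IsFutureTimelikeCurveOn τ.reverse γ (Icc a b)) :
    γ b ∈ g.chronologicalPast τ {γ a} :=
  ⟨γ a, rfl, γ, a, b, hab, hγ, rfl, rfl⟩

/-- The final point of a future timelike segment lies in the chronological future of its initial
point: if `γ` is future timelike for `τ` on `[a, b]`, `a < b`, then `γ b ∈ I⁺(γ a)`. -/
private theorem mem_chronologicalFuture_of_curve {γ : ℝ → M} {a b : ℝ} (hab : a < b)
    (hγ : g.IsFutureTimelikeCurveOn τ γ (Icc a b)) :
    γ b ∈ g.chronologicalFuture τ {γ a} :=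
  ⟨γ a, rfl, γ, a, b, hab, hγ, rfl, rfl⟩

end CausalPast

/-! ### Last contact of a continuous curve with a closed set -/

/-- **Last contact.** Let `γ : ℝ → α` be continuous at every point of `[a, b]`, `C` closed,
`U ⊆ C` open, `γ a ∈ C`, `γ b ∉ C`. Then there is a last parameter `σ ∈ [a, b)` with `γ σ ∈ C`,
and `γ σ ∉ U` (otherwise `γ` would stay in `U ⊆ C` on a right neighbourhood of `σ`). -/
private theorem exists_last_contact {α : Type*} [TopologicalSpace α] {γ : ℝ → α} {a b : ℝ}
    (hab : a ≤ b) (hcont : ∀ t ∈ Icc a b, ContinuousAt γ t) {C U : Set α} (hC : IsClosed C)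
    (hU : IsOpen U) (hUC : U ⊆ C) (ha : γ a ∈ C) (hb : γ b ∉ C) :
    ∃ σ, a ≤ σ ∧ σ < b ∧ γ σ ∈ C ∧ γ σ ∉ U := by
  have hco : ContinuousOn γ (Icc a b) := fun t ht ↦ (hcont t ht).continuousWithinAt
  have hSc : IsClosed (Icc a b ∩ γ ⁻¹' C) := hco.preimage_isClosed_of_isClosed isClosed_Icc hC
  have hK : IsCompact (Icc a b ∩ γ ⁻¹' C) := isCompact_Icc.of_isClosed_subset hSc inter_subset_left
  have haS : a ∈ Icc a b ∩ γ ⁻¹' C := ⟨left_mem_Icc.mpr hab, ha⟩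
  obtain ⟨σ, ⟨⟨haσ, hσb⟩, hσC⟩, hmax⟩ := hK.exists_isGreatest ⟨a, haS⟩
  have hσC' : γ σ ∈ C := hσC
  have hσb' : σ < b := lt_of_le_of_ne hσb fun h ↦ hb (h ▸ hσC')
  refine ⟨σ, haσ, hσb', hσC', fun hmem ↦ ?_⟩
  -- `γ` stays in `U` on a right neighbourhood of `σ`, beyond the last contact
  have h1 : γ ⁻¹' U ∈ 𝓝[>] σ :=
    mem_nhdsWithin_of_mem_nhds ((hcont σ ⟨haσ, hσb⟩).preimage_mem_nhds (hU.mem_nhds hmem))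
  obtain ⟨s', hs'U, hs'σ, hs'b⟩ := Filter.nonempty_of_mem (inter_mem h1 (Ioc_mem_nhdsGT hσb'))
  have hle : s' ≤ σ := hmax ⟨⟨haσ.trans hs'σ.le, hs'b⟩, hUC hs'U⟩
  exact absurd hle (not_le.mpr hs'σ)

/-! ### The chart lines `s ↦ Ψ(x + s ∂₀)` -/

section ChartLine

/-- Chain rule for velocities: `(f ∘ γ)'(t) = df_{γ t}(γ' t)` (copy of the private
`velocity_comp'` of `…RecurrentlyFlatDispersesStubChartFuture`). -/
private theorem velocity_comp' {E' : Type*} [NormedAddCommGroup E'] [NormedSpace ℝ E']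
    {H' : Type*} [TopologicalSpace H'] {I' : ModelWithCorners ℝ E' H'} {N : Type*}
    [TopologicalSpace N] [ChartedSpace H' N]
    {E : Type*} [NormedAddCommGroup E] [NormedSpace ℝ E] {H : Type*} [TopologicalSpace H]
    {I : ModelWithCorners ℝ E H} {M : Type*} [TopologicalSpace M] [ChartedSpace H M]
    {f : N → M} {γ : ℝ → N} {t : ℝ} (hf : MDifferentiableAt I' I f (γ t))
    (hγ : MDifferentiableAt 𝓘(ℝ, ℝ) I' γ t) :
    velocity I (f ∘ γ) t = mfderiv I' I f (γ t) (velocity I' γ t) := by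
  simp only [velocity]
  rw [mfderiv_comp t hf hγ]
  rfl

/-- The straight line `s ↦ x₀ + s ∂₀` of `E4` has derivative `∂₀`. -/
private theorem hasDerivAt_line (x₀ : E4) (t : ℝ) :
    HasDerivAt (fun s : ℝ ↦ x₀ + s • (E4.basisVector 0 : E4)) (E4.basisVector 0 : E4) t := by
  simpa using ((hasDerivAt_id t).smul_const (E4.basisVector 0 : E4)).const_add x₀

/-- The straight line `s ↦ x₀ + s ∂₀` is smooth. -/
private theorem contDiff_line (x₀ : E4) :
    ContDiff ℝ ∞ (fun s : ℝ ↦ x₀ + s • (E4.basisVector 0 : E4)) :=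
  contDiff_const.add (contDiff_id.smul contDiff_const)

/-- The velocity of the straight line (as a curve in the manifold `E4`) is `∂₀`. -/
private theorem velocity_line (x₀ : E4) (t : ℝ) :
    velocity 𝓘(ℝ, E4) (fun s : ℝ ↦ x₀ + s • (E4.basisVector 0 : E4)) t =
      (E4.basisVector 0 : E4) := by
  simp only [velocity]
  rw [mfderiv_eq_fderiv, ← toSpanSingleton_deriv, (hasDerivAt_line x₀ t).deriv]
  exact one_smul ℝ _

/-- The time coordinate along the straight line is `x₀⁰ + s`. -/
private theorem line_apply_zero (x₀ : E4) (s : ℝ) :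
    (x₀ + s • (E4.basisVector 0 : E4)) 0 = x₀ 0 + s := by
  simp [E4.basisVector]

variable {𝓢 : Spacetime 4} {Ψ : Minkowski.background.domain → 𝓢.carrier}

/-- **The lifted chart line and its velocity.** For a smooth `Ψ : E4 → 𝓢` (domain the whole
background domain `⊤`) and a curve `c : ℝ → ⊤` whose underlying `E4`-curve is the straight line
`s ↦ x₀ + s ∂₀`, the lift `Ψ ∘ c` is differentiable and its velocity at `t` is `dΨ_{c t}(∂₀)`
(chain rule; the inclusion `⊤ ↪ E4` has identity differential, `mfderiv_subtypeVal`). -/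
private theorem line_lift (hΨ : ContMDiff 𝓘(ℝ, E4) (𝓡 4) ∞ Ψ) (x₀ : E4)
    {c : ℝ → Minkowski.background.domain}
    (hc : ∀ s : ℝ, (c s : E4) = x₀ + s • (E4.basisVector 0 : E4)) (t : ℝ) :
    MDifferentiableAt 𝓘(ℝ, ℝ) (𝓡 4) (Ψ ∘ c) t ∧
      velocity (𝓡 4) (Ψ ∘ c) t = mfderiv 𝓘(ℝ, E4) (𝓡 4) Ψ (c t) (E4.basisVector 0) := by
  have hcv : Subtype.val ∘ c = (fun s : ℝ ↦ x₀ + s • (E4.basisVector 0 : E4)) := funext hc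
  have hp_smooth : ContMDiff 𝓘(ℝ, ℝ) 𝓘(ℝ, E4) ∞
      (fun s : ℝ ↦ x₀ + s • (E4.basisVector 0 : E4)) :=
    contMDiff_iff_contDiff.mpr (contDiff_line x₀)
  have hc_smooth : ContMDiff 𝓘(ℝ, ℝ) 𝓘(ℝ, E4) ∞ c :=
    (ContMDiff.subtypeVal_comp_iff _ c).mp (hcv ▸ hp_smooth)
  have hct : MDifferentiableAt 𝓘(ℝ, ℝ) 𝓘(ℝ, E4) c t := hc_smooth.mdifferentiableAt (by simp)
  have hΨt : MDifferentiableAt 𝓘(ℝ, E4) (𝓡 4) Ψ (c t) := hΨ.mdifferentiableAt (by simp)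
  refine ⟨hΨt.comp t hct, ?_⟩
  -- velocity of `c` = velocity of the `E4`-line (identity differential of the inclusion)
  have hvc : velocity 𝓘(ℝ, E4) c t = (E4.basisVector 0 : E4) := by
    have h1 : velocity 𝓘(ℝ, E4) (Subtype.val ∘ c) t =
        mfderiv 𝓘(ℝ, E4) 𝓘(ℝ, E4) (Subtype.val : Minkowski.background.domain → E4) (c t)
          (velocity 𝓘(ℝ, E4) c t) :=
      velocity_comp' (hasMFDerivAt_subtypeVal (c t)).mdifferentiableAt hct
    rw [mfderiv_subtypeVal, hcv, velocity_line] at h1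
    exact h1.symm
  rw [velocity_comp' hΨt hct, hvc]

/-- **The chart lines are future timelike curves, so `Ψ(x + d ∂₀) ∈ I⁺(Ψ x)`** for `x⁰ ≥ τ₀`
and `d > 0`, when `dΨ(∂₀)` is future timelike on `{x⁰ ≥ τ₀}`: along `s ↦ Ψ(x + s ∂₀)`,
`s ∈ [0, d]`, the time coordinate is `x⁰ + s ≥ τ₀` and the velocity is `dΨ(∂₀)`. -/
private theorem line_mem_chronologicalFuture (hΨ : ContMDiff 𝓘(ℝ, E4) (𝓡 4) ∞ Ψ) {τ₀ : ℝ}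
    (hT : ∀ x : Minkowski.background.domain, τ₀ ≤ x.1 0 →
      𝓢.metric.IsTimelike (mfderiv 𝓘(ℝ, E4) (𝓡 4) Ψ x (E4.basisVector 0)) ∧
      𝓢.timeOrientation.IsFutureDirected (mfderiv 𝓘(ℝ, E4) (𝓡 4) Ψ x (E4.basisVector 0)))
    (x : Minkowski.background.domain) (hx : τ₀ ≤ x.1 0) {d : ℝ} (hd : 0 < d) :
    Ψ ⟨x.1 + d • (E4.basisVector 0 : E4), trivial⟩ ∈
      𝓢.metric.chronologicalFuture 𝓢.timeOrientation {Ψ x} := by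
  set c : ℝ → Minkowski.background.domain :=
    fun s ↦ ⟨x.1 + s • (E4.basisVector 0 : E4), trivial⟩ with hc
  have hc0 : c 0 = x := Subtype.ext (by simp [hc])
  have hcurve : 𝓢.metric.IsFutureTimelikeCurveOn 𝓢.timeOrientation (Ψ ∘ c) (Icc 0 d) := by
    intro s hs
    obtain ⟨hdiff, hvel⟩ := line_lift hΨ x.1 (c := c) (fun _ ↦ rfl) s
    have hs' : τ₀ ≤ (c s).1 0 := by
      show τ₀ ≤ (x.1 + s • (E4.basisVector 0 : E4)) 0
      rw [line_apply_zero]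
      linarith [hs.1]
    refine ⟨hdiff, ?_, ?_⟩
    · rw [hvel]
      exact (hT (c s) hs').1
    · rw [hvel]
      exact (hT (c s) hs').2
  have h := mem_chronologicalFuture_of_curve hd hcurve
  rw [Function.comp_apply, Function.comp_apply, hc0] at h
  exact h

/-- **From the closed half-space to the slab along the chart line**: if `τ₀ ≤ y⁰ ≤ τ₁` then
`Ψ y ∈ J⁻(Ψ{x⁰ = τ₁})` — either `y` is on the slab, or `Ψ y ≪ Ψ(y + (τ₁ - y⁰) ∂₀)`, a slab
point. -/
private theorem mem_causalPast_image_timeSlab (hΨ : ContMDiff 𝓘(ℝ, E4) (𝓡 4) ∞ Ψ) {τ₀ τ₁ : ℝ}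
    (hT : ∀ x : Minkowski.background.domain, τ₀ ≤ x.1 0 →
      𝓢.metric.IsTimelike (mfderiv 𝓘(ℝ, E4) (𝓡 4) Ψ x (E4.basisVector 0)) ∧
      𝓢.timeOrientation.IsFutureDirected (mfderiv 𝓘(ℝ, E4) (𝓡 4) Ψ x (E4.basisVector 0)))
    (y : Minkowski.background.domain) (hy₀ : τ₀ ≤ y.1 0) (hy₁ : y.1 0 ≤ τ₁) :
    Ψ y ∈ 𝓢.metric.causalPast 𝓢.timeOrientation (Ψ '' Minkowski.background.timeSlab τ₁) := by
  rcases hy₁.eq_or_lt with heq | hlt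
  · exact LorentzianMetric.subset_causalPast _ _ _
      (mem_image_of_mem Ψ (show Minkowski.background.time y.1 = τ₁ from heq))
  · have hd : 0 < τ₁ - y.1 0 := sub_pos.mpr hlt
    have h1 := line_mem_chronologicalFuture hΨ hT y hy₀ hd
    have h2 : Ψ y ∈ 𝓢.metric.causalPast 𝓢.timeOrientation
        {Ψ ⟨y.1 + (τ₁ - y.1 0) • (E4.basisVector 0 : E4), trivial⟩} :=
      chronologicalPast_subset_causalPast _
        (LorentzianMetric.mem_chronologicalPast_of_mem_chronologicalFuture h1)
    refine causalPast_mono ?_ h2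
    rw [singleton_subset_iff]
    refine mem_image_of_mem Ψ ?_
    show (y.1 + (τ₁ - y.1 0) • (E4.basisVector 0 : E4)) 0 = τ₁
    rw [line_apply_zero]
    ring

end ChartLine

/-! ### The stub -/

/-- **Honesty of a proper future-timelike-fibred chart** (registered stub `stub_honestEnd` of crux
stmt-FinalStateConjecture-17283, `RadiativeEnd → HonestEnd` unfolded over tree vocabulary). For
every Cauchy development `𝒟`, every `τ₀` and every smooth `Ψ : E4 → M` which is an open embedding
of `{x⁰ > τ₀}`, proper on `{x⁰ ≥ τ₀}` (`Ψ{x⁰ ≥ τ₀}` closed) and has `Ψ_* ∂₀` future timelike there: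
(H1) `Ψ{x⁰ > τ₀} ⊆ I⁻(Ψ{x⁰ > τ₀})` and (H2) for every `τ₁ ≥ τ₀`, every point of
`J⁺(ι X) ∩ I⁻(Ψ{x⁰ > τ₀})` outside `Ψ{x⁰ > τ₁}` lies in `J⁻(Ψ{x⁰ = τ₁})`. O'Neill 1983, Ch. 14,
pp. 402–404 (chronological/causal relations, time duality, `J ∘ J = J`). -/
theorem stub_honestEnd :
  ∀ (X : Type) [TopologicalSpace X] [ChartedSpace E3 X] [IsManifold (𝓡 3) ∞ X] [ConnectedSpace X]
    (D : InitialDataSet (𝓡 3) X) (𝒟 : CauchyDevelopment D) (τ₀ : ℝ)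
    (Ψ : Minkowski.background.domain → 𝒟.carrier),
    ContMDiff 𝓘(ℝ, E4) (𝓡 4) ∞ Ψ →
    IsOpenEmbedding ((Minkowski.background.lateRegion τ₀).restrict Ψ) →
    IsClosed (Ψ '' {x : Minkowski.background.domain | τ₀ ≤ x.1 0}) →
    (∀ x : Minkowski.background.domain, τ₀ ≤ x.1 0 →
      𝒟.metric.IsTimelike (mfderiv 𝓘(ℝ, E4) (𝓡 4) Ψ x (E4.basisVector 0)) ∧
      𝒟.timeOrientation.IsFutureDirected (mfderiv 𝓘(ℝ, E4) (𝓡 4) Ψ x (E4.basisVector 0))) →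
    Ψ '' Minkowski.background.lateRegion τ₀ ⊆
      𝒟.metric.chronologicalPast 𝒟.timeOrientation (Ψ '' Minkowski.background.lateRegion τ₀) ∧
    ∀ τ₁ : ℝ, τ₀ ≤ τ₁ →
      exteriorOf 𝒟 (Ψ '' Minkowski.background.lateRegion τ₀) \
          Ψ '' Minkowski.background.lateRegion τ₁ ⊆
        𝒟.metric.causalPast 𝒟.timeOrientation (Ψ '' Minkowski.background.timeSlab τ₁) := by
  intro X _ _ _ _ D 𝒟 τ₀ Ψ hΨ hemb hcl hT
  -- `U := Ψ{x⁰ > τ₀}` is open and contained in the closed `C := Ψ{x⁰ ≥ τ₀}`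
  have hUC : Ψ '' Minkowski.background.lateRegion τ₀ ⊆
      Ψ '' {x : Minkowski.background.domain | τ₀ ≤ x.1 0} :=
    image_mono fun x hx ↦ le_of_lt (ModelBackground.mem_lateRegion.mp hx)
  have hUopen : IsOpen (Ψ '' Minkowski.background.lateRegion τ₀) := by
    rw [← range_restrict]
    exact hemb.isOpen_range
  refine ⟨?_, fun τ₁ hτ₁ p hp ↦ ?_⟩
  · -- (H1) `U ⊆ I⁻(U)` along the chart lines
    rintro _ ⟨x, hx, rfl⟩
    have hx' : τ₀ ≤ x.1 0 := le_of_lt (ModelBackground.mem_lateRegion.mp hx)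
    have h1 := line_mem_chronologicalFuture (𝓢 := 𝒟.toSpacetime) hΨ hT x hx' one_pos
    refine chronologicalPast_mono ?_
      (LorentzianMetric.mem_chronologicalPast_of_mem_chronologicalFuture h1)
    rw [singleton_subset_iff]
    refine mem_image_of_mem Ψ ?_
    show τ₀ < (x.1 + (1 : ℝ) • (E4.basisVector 0 : E4)) 0
    rw [line_apply_zero]
    linarith
  -- (H2) exhaustion at chart time `τ₁ ≥ τ₀`
  obtain ⟨⟨-, hpI⟩, hpnot⟩ := hp
  by_cases hpC : p ∈ Ψ '' {x : Minkowski.background.domain | τ₀ ≤ x.1 0}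
  · -- case A: `p = Ψ x` with `τ₀ ≤ x⁰ ≤ τ₁`
    obtain ⟨x, hx₀, rfl⟩ := hpC
    have hx₁ : x.1 0 ≤ τ₁ := not_lt.mp fun h ↦ hpnot (mem_image_of_mem Ψ h)
    exact mem_causalPast_image_timeSlab (𝓢 := 𝒟.toSpacetime) hΨ hT x hx₀ hx₁
  · -- case B: `p ∉ C`; last contact of a past-directed timelike curve from `U` to `p` with `C`
    obtain ⟨q, hqU, γ, a, b, hab, hγ, hγa, hγb⟩ := hpI
    have hcont : ∀ t ∈ Icc a b, ContinuousAt γ t := fun t ht ↦ (hγ t ht).1.continuousAt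
    have ha : γ a ∈ Ψ '' {x : Minkowski.background.domain | τ₀ ≤ x.1 0} := by
      rw [hγa]; exact hUC hqU
    have hb : γ b ∉ Ψ '' {x : Minkowski.background.domain | τ₀ ≤ x.1 0} := by
      rw [hγb]; exact hpC
    obtain ⟨σ, haσ, hσb, hσC, hσU⟩ := exists_last_contact hab.le hcont hcl hUopen hUC ha hb
    -- the last contact point is `Ψ y` with `y⁰ = τ₀`
    obtain ⟨y, hy₀, hyσ⟩ := hσC
    have hy₀' : τ₀ ≤ y.1 0 := hy₀
    have hy₁ : y.1 0 ≤ τ₀ := by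
      refine not_lt.mp fun h ↦ hσU ?_
      rw [← hyσ]
      exact mem_image_of_mem Ψ (show y ∈ Minkowski.background.lateRegion τ₀ from h)
    -- `γ σ = Ψ y ∈ J⁻(Ψ{x⁰ = τ₁})` along the chart line
    have hyslab := mem_causalPast_image_timeSlab (𝓢 := 𝒟.toSpacetime) hΨ hT y hy₀' (hy₁.trans hτ₁)
    rw [hyσ] at hyslab
    -- `p ∈ I⁻(γ σ) ⊆ J⁻(γ σ)` along `γ|[σ, b]`
    have hpσ : p ∈ 𝒟.metric.causalPast 𝒟.timeOrientation {γ σ} := by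
      have h := mem_chronologicalPast_of_reverse_curve hσb (hγ.mono (Icc_subset_Icc_left haσ))
      rw [hγb] at h
      exact chronologicalPast_subset_causalPast _ h
    -- transitivity of `J⁻`
    rw [← causalPast_causalPast_eq two_le_infty]
    exact causalPast_mono (singleton_subset_iff.mpr hyslab) hpσ

end Summit.FinalStateConjecture.FinalStateConjecture.Theorems.DrainImpliesDisperse

end
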